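import Summits.QuantumFields.BalabanUV.T4Continuum.Support.ShellMeasureWilsonRemainderLevelsCov
import Summits.QuantumFields.BalabanUV.T4Continuum.Support.ShellMeasurePlaquetteCubicAssembly

/-!
# `T4Continuum.ShellMeasurePlaquetteCubicAssemblyLevels` — row S65 f5d (part c, THE LIVE LEVELS): (98) FOR THE
# `η`-SCALED ACTUAL ACTION FROM `max{|·|_{(−1)}, |∇·|_{(−2)}}` — f5c's `∇`-part at the `η`-FREE weight `w = i∕2` plus
# J1's `∇`-free part (leaf-03-g5), added by f2c `Prop4Hyp.add`; NO `Prop4Hyp` hypothesis left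
# (cell `pub-balaban`, sub-cell `t4`, spine estimate NE7c (node U5b), crew lineage `b2b-balaban-t4-ne7c-formalise-leaf-02`
# gen 8, owner table `LEAVES-NE7c-P1.md` row S65; imports leaf-03-g5's J1 file 2 `ShellMeasureWilsonRemainderLevelsCov`
# (p225758) and this lineage's f5d-b `ShellMeasurePlaquetteCubicAssembly` ONLY; [folklore]; 0 sorry, 0 def)

HONEST FRAMING.  Finite four-torus programme, rung (B)+1 only — NOT infinite volume, NOT a mass gap, NOT the Clay
problem, NOT summit progress; (B), `BetaPertHyp`, (B^μ) are not consumed.  NE7c (`T4IndicatorShell.ShellWeightBound`)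
is NOT PRINTED and NOT PROVED; «NE7c ⇐ the named binders» (WALL `t4/b2b-balaban-t4-ne7c-p1/WALL-NE7c-P1.md` §2).
ELEMENTARY bookkeeping ([folklore]); [Balaban1985Variational] (38)∕(39)∕(97)∕(98) are LOCATORS for the shape only — the
paper is under adjudication; nothing printed is asserted or cited as a fact; no `def` is minted.
HONEST DEPENDENCY (cell): continuum YM on T⁴ ⇐ BetaPertH ∧ nine spine estimates (0/9 proved); BetaPertH ⇐ (D1) ∧ (D4)
∧ CAP+tail; G-an2-4 gates asym, D1 and NE2/3/4.

THE POINT.  At the live levels the one-grid functional `R` is read on the `η`-lattice field in the pairing currency of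
S63 (a): `etaScale η R A′ = η⁻⁴·R(η•A′)` (leaf-03-g5's J1, `ShellMeasureWilsonRemainderLevels`).  By f5d-a's dictionary
`Σ_p ord₃ plaqFunSym_p = cubT (iη∕2) + Σ_p V0remCov_p` and J1's `etaScale_cubT` (a cubic form rescales by `η³`, the
currency divides by `η⁴`, the weight is linear): **`etaScale η (Σ_p ord₃ plaqFunSym_p) = cubT (i∕2) + Σ_p etaScale η
(V0remCov_p)`** (`etaScale_sum_ord₃_eq`) — the `∇`-part's weight is `η`-FREE, so f5c's constant `144(d−1)·‖w‖·‖τ‖·Lc³`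
reads `72(d−1)·‖τ‖·Lc³`, k-UNIFORM as it must be.  THIS FILE:
* `etaScale_sum_ord₃_eq`, `differentiable_sum_etaScale_V0remCov`, **`locGrad_etaScale_sum_ord₃_eq`** (the gradient
  splits at every field);
* **`prop4Hyp_locGrad_ord₃_eta_levels`**: under f5c's geometric hypotheses (positive bond weights `wt` — Bałaban's
  `L^{j(b)}η` —, derivative weights `wd`, a `∇`-datum `Dv` dominating the covariant derivatives near each bond with floors
  `Wf`, `Wd` within the scale jump `Lc` of the bond's weight; `Pl` ⊇ stars, increasing; `U₀` `U1`-valued; `τ` tracial;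
  `η > 0`) AND J1's (per-plaquette weights `η ≤ W p ≤ wt b ≤ Lc·W p` on `∂p`, the per-plaquette background regularity
  `‖U₀(∂p) − 1‖ ≤ ε₀·(η∕W p)²` — print's (38) «hidden η²» as a DISPLAYED binder —, boundaries `bd p = ∂p` oriented
  `(+, +, −, −)`, field cap `4ε ≤ 1`, incidence `≤ m`):
  `Prop4Hyp (Y ↦ locGrad (etaScale η (Σ_{p∈Pl} ord₃ (plaqFunSym τ U (bd p)))) Y)
     (72(d−1)·‖τ‖·Lc³ + 8·‖τ‖·(248∕3·ε₀ + 40∕3·ε)·m·Lc⁴) (ε∕2)` from `WMax wt wd Dv` to `WSup wt 3 (𝔸 →L[ℂ] ℂ)` —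
  END-II's `hW` SHAPE ([Balaban1985Variational] Prop. 4 (97)∕(98) TYPE) for OUR `η`-scaled one-grid Wilson action's
  order-≥3 part at the live levels, constant VOLUME-FREE and k-UNIFORM, EVERY hypothesis geometric∕displayed, NO
  `Prop4Hyp` or estimate assumed (f5c `prop4Hyp_locGrad_cubT_levels` at `w = i∕2` + J1 `prop4Hyp_locGrad_V0remCov_eta_levels_max`
  + f2c `Prop4Hyp.add` + f5d-b `prop4Hyp_congr`∕`locGrad_add`).
WHAT ROW S65 NOW SAYS (c3-honest): the (P4)-type binder for the (39)-split plaquette action is KERNEL at one grid (f5d-b)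
and at the live levels (here) IN OUR TYPING; what remains DISPLAYED is the identification of `Λ, Pl, bd, wt, wd, W, Wf, Wd,
Dv, U₀, η, ε₀` with Bałaban's sectioned objects on `Ω_j` (node O ∕ [dict]), the HD-dressing `A″ = A′ − HD(A′)` of (80)
(S66) and END-II's other binders.  NOTHING in the countdown moves; no estimate of Bałaban's at a live level is discharged
by citation.
-/

noncomputable section

open scoped BigOperators

namespace Summit.QuantumFields.BalabanUV.T4Continuum.ShellMeasurePlaquetteCubicAssemblyLevels

open Literature.MathematicalPhysics.QuantumFieldTheory.Balaban1983to89
open B7Prop1Explicit (e U1 mem_U1)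
open B8Ineq132 (covDerivFwd)
open B11Prop6Scheme (Prop4Hyp)
open ShellMeasureWilsonGradientTail (plaqWord bonds)
open ShellMeasurePlaquetteTwist (plaqFunSym)
open ShellMeasureLocalGradientTailJet (ord₃)
open Summit.QuantumFields.BalabanUV.T4Continuum.ShellMeasureCommutatorVariation (plaqStar)
open Summit.QuantumFields.BalabanUV.T4Continuum.ShellMeasureCommutatorGradientLocal (baseSites nbhdSites)
open Summit.QuantumFields.BalabanUV.T4Continuum.ShellMeasureCommutatorLocGrad (ext cubT differentiable_cubT)
open Summit.QuantumFields.BalabanUV.T4Continuum.ShellMeasureCommutatorLevels (prop4Hyp_locGrad_cubT_levels)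
open Summit.QuantumFields.BalabanUV.T4Continuum.ShellMeasureLocalGradientTail (locGrad)
open Summit.QuantumFields.BalabanUV.T4Continuum.ShellMeasureMultiGridNorms
open Summit.QuantumFields.BalabanUV.T4Continuum.ShellMeasureMultiGridNormsMax
open Summit.QuantumFields.BalabanUV.T4Continuum.ShellMeasurePlaquetteCubicDictionary (V0remCov sum_ord₃_eq_cubT_add)
open Summit.QuantumFields.BalabanUV.T4Continuum.ShellMeasurePlaquetteCubicCovBinders (analyticAt_V0remCov)
open Summit.QuantumFields.BalabanUV.T4Continuum.ShellMeasureWilsonRemainderLevels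
  (etaScale analyticAt_etaScale sum_etaScale)
open Summit.QuantumFields.BalabanUV.T4Continuum.ShellMeasureWilsonRemainderLevelsCov
  (etaScale_add etaScale_cubT prop4Hyp_locGrad_V0remCov_eta_levels_max)
open Summit.QuantumFields.BalabanUV.T4Continuum.ShellMeasurePlaquetteCubicAssembly
  (locGrad_add prop4Hyp_congr restr_unit_bounded)

export B7Prop1Explicit (Site)

variable {d : ℕ} {𝔸 : Type*} [NormedRing 𝔸] [NormOneClass 𝔸] [NormedAlgebra ℂ 𝔸] [CompleteSpace 𝔸]
  (Λ : Finset (Site d × Fin d)) (Pl : Finset (Fin d × Fin d × Site d)) (τ : 𝔸 →L[ℂ] ℂ)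
  {U₀ : Site d → Fin d → 𝔸ˣ} (h₀ : ∀ y κ, U₀ y κ ∈ U1 𝔸) (bd : Fin d × Fin d × Site d → (Fin 4 → ↥Λ × Bool))

/-! ## §1 The split in the `η`-currency -/

omit [NormOneClass 𝔸] in
/-- **THE `η`-SCALED ACTION SPLITS WITH AN `η`-FREE `∇`-PART**: for a tracial `τ`, `η ≠ 0` and boundaries `bd p = ∂p`:
`etaScale η (Σ_p ord₃ plaqFunSym_p) = cubT Λ Pl (i∕2) τ η U₀ + Σ_p etaScale η (V0remCov_p)` as functions of the field
(f5d-a `sum_ord₃_eq_cubT_add` + J1 `etaScale_add`∕`etaScale_cubT`∕`sum_etaScale`; `η⁻¹·(iη∕2) = i∕2`). [folklore] -/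
theorem etaScale_sum_ord₃_eq (htr : ∀ P Q : 𝔸, τ (P * Q) = τ (Q * P)) {η : ℝ} (hη : η ≠ 0)
    (hbd : ∀ p ∈ Pl, ((bd p 0).1 : Site d × Fin d) = (p.2.2, p.1) ∧ ((bd p 1).1 : Site d × Fin d) = (p.2.2 + e p.1, p.2.1)
      ∧ ((bd p 2).1 : Site d × Fin d) = (p.2.2 + e p.2.1, p.1) ∧ ((bd p 3).1 : Site d × Fin d) = (p.2.2, p.2.1)) :
    etaScale η (fun A : ↥Λ → 𝔸 => ∑ p ∈ Pl, ord₃ (plaqFunSym τ (fun b : ↥Λ => U₀ b.1.1 b.1.2) (bd p)) A) =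
      fun A => cubT Λ Pl (Complex.I / 2) τ η U₀ A
        + ∑ p ∈ Pl, etaScale η (V0remCov τ (fun b : ↥Λ => U₀ b.1.1 b.1.2) (bd p)) A := by
  have hηC : (η : ℂ) ≠ 0 := Complex.ofReal_ne_zero.2 hη
  have hfun : (fun A : ↥Λ → 𝔸 => ∑ p ∈ Pl, ord₃ (plaqFunSym τ (fun b : ↥Λ => U₀ b.1.1 b.1.2) (bd p)) A) =
      fun A => cubT Λ Pl (Complex.I * η / 2) τ η U₀ A
        + ∑ p ∈ Pl, V0remCov τ (fun b : ↥Λ => U₀ b.1.1 b.1.2) (bd p) A :=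
    funext fun A => sum_ord₃_eq_cubT_add Λ Pl τ U₀ bd htr hη hbd A
  have hw : ((η : ℂ))⁻¹ * (Complex.I * η / 2) = Complex.I / 2 := by
    field_simp
  funext A
  rw [hfun, etaScale_add, etaScale_cubT τ Λ Pl (Complex.I * η / 2) hη U₀ A, hw, ← sum_etaScale]

include h₀ in
/-- The scaled `∇`-free family is entire, hence its sum is differentiable. [folklore] -/
theorem differentiable_sum_etaScale_V0remCov (η : ℝ) :
    Differentiable ℂ fun A : ↥Λ → 𝔸 =>
      ∑ p ∈ Pl, etaScale η (V0remCov τ (fun b : ↥Λ => U₀ b.1.1 b.1.2) (bd p)) A := by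
  obtain ⟨hU, hU'⟩ := restr_unit_bounded Λ h₀
  exact Differentiable.fun_sum fun p _ A =>
    (analyticAt_etaScale (analyticAt_V0remCov τ (bd p) hU hU') η A).differentiableAt

include h₀ in
/-- **THE GRADIENT OF THE `η`-SCALED ACTION SPLITS** at every field:
`locGrad (etaScale η (Σ_p ord₃ plaqFunSym_p)) A = locGrad (cubT Λ Pl (i∕2) τ η U₀) A + locGrad (Σ_p etaScale η V0remCov_p) A`.
[folklore] -/
theorem locGrad_etaScale_sum_ord₃_eq (htr : ∀ P Q : 𝔸, τ (P * Q) = τ (Q * P)) {η : ℝ} (hη : η ≠ 0)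
    (hbd : ∀ p ∈ Pl, ((bd p 0).1 : Site d × Fin d) = (p.2.2, p.1) ∧ ((bd p 1).1 : Site d × Fin d) = (p.2.2 + e p.1, p.2.1)
      ∧ ((bd p 2).1 : Site d × Fin d) = (p.2.2 + e p.2.1, p.1) ∧ ((bd p 3).1 : Site d × Fin d) = (p.2.2, p.2.1))
    (A : ↥Λ → 𝔸) :
    locGrad (etaScale η (fun A : ↥Λ → 𝔸 =>
        ∑ p ∈ Pl, ord₃ (plaqFunSym τ (fun b : ↥Λ => U₀ b.1.1 b.1.2) (bd p)) A)) A =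
      locGrad (cubT Λ Pl (Complex.I / 2) τ η U₀) A
        + locGrad (fun A => ∑ p ∈ Pl, etaScale η (V0remCov τ (fun b : ↥Λ => U₀ b.1.1 b.1.2) (bd p)) A) A := by
  rw [etaScale_sum_ord₃_eq Λ Pl τ bd htr hη hbd]
  exact locGrad_add ((differentiable_cubT Λ Pl (Complex.I / 2) τ η U₀) A)
    ((differentiable_sum_etaScale_V0remCov Λ Pl τ h₀ bd η) A)

/-! ## §2 (98) at the live levels for the `η`-scaled action — both halves kernel, added -/

/-- `‖i∕2‖ = ½`. [folklore] -/
theorem norm_I_div_two : ‖(Complex.I / 2 : ℂ)‖ = 1 / 2 := by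
  rw [norm_div, Complex.norm_I, RCLike.norm_ofNat]

variable (wt : ↥Λ → ℝ) [hwt : Fact (∀ b, 0 < wt b)] {I : Type*} [Fintype I] (wd : I → ℝ) [hwd : Fact (∀ i, 0 < wd i)]
  (Dv : (↥Λ → 𝔸) →L[ℂ] (I → 𝔸)) (Wf Wd : ↥Λ → ℝ) (W : Fin d × Fin d × Site d → ℝ)

include h₀ in
/-- **(98) FOR THE `η`-SCALED WILSON ACTION'S ORDER-≥3 PART AT THE LIVE LEVELS — BOTH HALVES KERNEL.**  Data and
DISPLAYED geometric hypotheses: `Λ` a finite bond set of b08's lattice, `Pl` a finite family of increasing plaquettes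
containing every star (`hincr`, `hst`), boundaries `bd p = ∂p_{μν}(x)` (`hbd`) oriented `(+, +, −, −)` (`hor`); a
`U1`-valued background with the PER-PLAQUETTE regularity `‖U₀(∂p) − 1‖ ≤ ε₀·(η∕W p)²` (`hreg`); a tracial `τ`; `η > 0`;
positive bond weights `wt`, plaquette weights `η ≤ W p ≤ wt b ≤ Lc·W p` on `∂p`, per-bond floors `Wf b ≤ wt b′` on
`nbhdSites`, `wt b ≤ Lc·Wf b`, `wt b ≤ Lc·Wd b`, `1 ≤ Lc`; a `∇`-datum `Dv` read in `WSup wd 2` dominating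
`(Wd b)²·‖(D^η_{U₀}(ext A))(x)‖` on `baseSites`; a field cap `0 < ε`, `4ε ≤ 1`; an incidence bound `m`.  Conclusion,
from f2c's `WMax wt wd Dv` (`max{|A′|_{(−1)}, |∇A′|_{(−2)}}`) to `WSup wt 3 (𝔸 →L[ℂ] ℂ)` (`|·|_{(−3)}`):
`Prop4Hyp (Y ↦ locGrad (etaScale η (Σ_{p∈Pl} ord₃ (plaqFunSym τ U (bd p)))) Y)
  (72(d−1)·‖τ‖·Lc³ + 8·‖τ‖·(248∕3·ε₀ + 40∕3·ε)·m·Lc⁴) (ε∕2)` — [Balaban1985Variational] Prop. 4 (97)∕(98) TYPE for OUR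
action, constant VOLUME-FREE and k-UNIFORM; nothing printed is asserted; the [dict] to `Ω_j` is node O's. [folklore] -/
theorem prop4Hyp_locGrad_ord₃_eta_levels {η : ℝ} (hη : 0 < η) (htr : ∀ P Q : 𝔸, τ (P * Q) = τ (Q * P))
    (hincr : ∀ p ∈ Pl, p.1 < p.2.1) (hst : ∀ b : ↥Λ, plaqStar b.1.1 b.1.2 ⊆ Pl)
    (hbd : ∀ p ∈ Pl, ((bd p 0).1 : Site d × Fin d) = (p.2.2, p.1) ∧ ((bd p 1).1 : Site d × Fin d) = (p.2.2 + e p.1, p.2.1)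
      ∧ ((bd p 2).1 : Site d × Fin d) = (p.2.2 + e p.2.1, p.1) ∧ ((bd p 3).1 : Site d × Fin d) = (p.2.2, p.2.1))
    (hor : ∀ p ∈ Pl, (bd p 0).2 = true ∧ (bd p 1).2 = true ∧ (bd p 2).2 = false ∧ (bd p 3).2 = false)
    {Lc : ℝ} (hLc : 1 ≤ Lc) (hWf0 : ∀ b, 0 < Wf b) (hWd0 : ∀ b, 0 < Wd b)
    (hWf : ∀ b b' : ↥Λ, b'.1.1 ∈ nbhdSites b.1.1 b.1.2 → Wf b ≤ wt b')
    (hcf : ∀ b, wt b ≤ Lc * Wf b) (hcd : ∀ b, wt b ≤ Lc * Wd b)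
    (hDv : ∀ (A : ↥Λ → 𝔸) (b : ↥Λ) (x : Site d) (κ' τ' : Fin d), x ∈ baseSites b.1.1 →
      Wd b ^ 2 * ‖covDerivFwd η U₀ κ' (fun z => ext Λ A z τ') x‖ ≤ ‖(WSup.toPiL wd 2).symm (Dv A)‖)
    {ε ε₀ : ℝ} (hε : 0 < ε) (hε₀ : 0 ≤ ε₀) (hε4 : 4 * ε ≤ 1) (hηW : ∀ p ∈ Pl, η ≤ W p)
    (hWw : ∀ p ∈ Pl, ∀ b ∈ bonds (bd p), W p ≤ wt b) (hwW : ∀ p ∈ Pl, ∀ b ∈ bonds (bd p), wt b ≤ Lc * W p)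
    (hreg : ∀ p ∈ Pl, ‖(plaqWord (fun b : ↥Λ => U₀ b.1.1 b.1.2) (bd p) (0 : ↥Λ → 𝔸) : 𝔸) - 1‖ ≤ ε₀ * (η / W p) ^ 2)
    {m : ℕ} (hm : ∀ b : ↥Λ, (Pl.filter (fun p => b ∈ bonds (bd p))).card ≤ m) :
    Prop4Hyp (fun Y : WMax wt wd Dv =>
        (WSup.toPiL wt 3).symm
          (locGrad (etaScale η (fun A : ↥Λ → 𝔸 =>
              ∑ p ∈ Pl, ord₃ (plaqFunSym τ (fun b : ↥Λ => U₀ b.1.1 b.1.2) (bd p)) A))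
            (WMax.toPiL wt wd Dv Y)))
      (72 * ((d : ℝ) - 1) * ‖τ‖ * Lc ^ 3 + 8 * ‖τ‖ * (248 / 3 * ε₀ + 40 / 3 * ε) * m * Lc ^ 4) (ε / 2) := by
  obtain ⟨hU, hU'⟩ := restr_unit_bounded Λ h₀
  -- the `∇`-part at the `η`-free weight `i∕2` (f5c) and the `∇`-free part in the `η`-currency (J1)
  have hgrad := prop4Hyp_locGrad_cubT_levels Λ Pl (Complex.I / 2) wt wd Dv Wf Wd hη h₀ htr hincr hst hLc hWf0 hWd0
    hWf hcf hcd hDv (ε / 2)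
  have hfree := prop4Hyp_locGrad_V0remCov_eta_levels_max Pl bd wt W τ hU hU' wd Dv hη hε hε₀ hε4 hLc hor hηW hWw
    hwW hreg hm
  have hsum := ShellMeasureMultiGridNormsMax.Prop4Hyp.add hgrad hfree
  have heq : ∀ Y : WMax wt wd Dv,
      (WSup.toPiL wt 3).symm
          (locGrad (etaScale η (fun A : ↥Λ → 𝔸 =>
              ∑ p ∈ Pl, ord₃ (plaqFunSym τ (fun b : ↥Λ => U₀ b.1.1 b.1.2) (bd p)) A))
            (WMax.toPiL wt wd Dv Y)) =
        ((fun Y : WMax wt wd Dv =>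
            (WSup.toPiL wt 3).symm (locGrad (cubT Λ Pl (Complex.I / 2) τ η U₀) (WMax.toPiL wt wd Dv Y)))
          + fun Y : WMax wt wd Dv =>
            ((WSup.toPiL wt 3).symm
              (locGrad (fun A => ∑ p ∈ Pl, etaScale η (V0remCov τ (fun b : ↥Λ => U₀ b.1.1 b.1.2) (bd p)) A)
                (WSup.toPiL wt 1 (WMax.toWSupL wt wd Dv Y))) : WSup wt 3 (𝔸 →L[ℂ] ℂ))) Y := by
    intro Y
    have hid : WSup.toPiL wt 1 (WMax.toWSupL wt wd Dv Y) = WMax.toPiL wt wd Dv Y := rfl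
    rw [Pi.add_apply, hid, ← map_add, locGrad_etaScale_sum_ord₃_eq Λ Pl τ h₀ bd htr hη.ne' hbd]
  refine ShellMeasureMultiGridNormsMax.Prop4Hyp.mono (prop4Hyp_congr hsum heq) (le_of_eq ?_) le_rfl
  rw [norm_I_div_two]
  ring

end Summit.QuantumFields.BalabanUV.T4Continuum.ShellMeasurePlaquetteCubicAssemblyLevels

end
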